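import Summits.KontsevichZagierPeriods.KontsevichZagierPeriods.Theses.HermiteRigidity
import Literature.NumberTheory.Transcendental.KZKernelConjectureForms
import Literature.NumberTheory.EllipticCurves.RealLatticePeriodDiscrProofs

/-!
# `RealEllipticSectorKernel` (stmt-KontsevichZagierPeriods-10632): negative side — shape of any refutation, load-bearing hypotheses

Negative-side support for the crux `RealEllipticSectorKernel` of route `HermiteRigidity`
(cdisprove unit, refuter seat `refuter-cdisprove-stmt-KontsevichZagierPeriods-10632-0`; running
commentary in the crux work file `Cruxes/RealEllipticSectorKernel/Disproof.lean`). The crux: for a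
rational cubic `f = 4x³ − q₂x − q₃` with `Δ > 0`, IF `1, J₀, J₁, K₀, K₁` (the four basic real
(quasi-)period integrals over the two bounded ovals) are linearly independent over the real
algebraic numbers, THEN every `ℤ`-combination of the sector generators `[σ, xᵐ/√f]`,
`[σ', xᵐ/√(−f)]`, `[σ'', 1/√f]` of value `0` lies in `KZ.relations`. Nothing here refutes it.
This file records, as theorems other seats can import:

* §0 the crux unbundled (`cubic`, `σ₁ σ₂ σ₃`, `J₀ J₁ K₀ K₁`, `Rigidity`, `Gens`, `Kernel`,
  `crux_iff` by `Iff.rfl`);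
* §1 the shape of any refutation: `not_summit_of_not` (a refutation of the crux refutes
  Conjecture 1 as formalised — the kernel conjecture implies the crux with the rigidity hypothesis
  unused), `not_iff` (a witness must PROVE rigidity for a concrete cubic: Schneider/Masser-type
  transcendence, absent from the tree), `not_of_separating_invariant` (template);
* §2 `0 < Δ` is NOT load-bearing: the rigidity hypothesis forces `σ ≠ ∅`, and a `+ → −` sign
  change of the cubic forces `Δ = (A − 3e²)(12e² − A)² > 0` (`discr_pos_of_sign_change`,
  `withoutDiscr_iff`: deleting `0 < Δ` gives an EQUIVALENT statement);
* §3 with REAL instead of real-algebraic coefficients the hypothesis fails for every curve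
  (`not_realCoeffRigidity`), so that variant is vacuous;
* §4 the proof plan (Hermite reduction + the two-torsion move) consumes only ℚ-linear
  independence of `(J₀, J₁, K₀, K₁)` (`QRigidity`); the sharpened statement implies the crux
  (`crux_of_sharpened`);
* §5 on the CM family `q₃ = 0` one has `K₀ = J₀` (`x ↦ −x`, one rule-2 move), so the inlined
  hypothesis provably fails (`not_rigidity_q₃_zero`): the crux is silent there by design;
* §6 generators presenting the same integral (same domain, integrands equal ON it) are
  equivalent by one domain-additivity move (`equivalent_of_eqOn`).

Companion file: `GeneratorNotRelation.lean` (the generator `[(1,∞), 1/√(4x³−4x)]` is an honest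
representation of value `Γ(1/4)²/(4√(2π))`, hence not a relation: `eval c = 0` is load-bearing).

Sources: M. Kontsevich, D. Zagier, *Periods* (2001), §§1.1–1.2; D. Masser, *Elliptic Functions
and Transcendence*, LNM 437 (1975), Ch. II Thm II; D. F. Lawden, *Elliptic Functions and
Applications* (1989), §6.12. -/

noncomputable section

namespace Summit.KontsevichZagierPeriods.RealEllipticSectorKernel.Negative

open MeasureTheory Set
open Literature.NumberTheory.Transcendental Literature.ModelTheory.ExponentialFields
open Summit.KontsevichZagierPeriods.KontsevichZagierPeriods.Theses.HermiteRigidity (RealEllipticSectorKernel)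

/-! ### §0 The crux, unbundled -/

/-- The Weierstrass cubic `f(x) = 4x³ − q₂x − q₃`. [folklore] -/
def cubic (q₂ q₃ : ℚ) (x : ℝ) : ℝ := 4 * x ^ 3 - (q₂ : ℝ) * x - (q₃ : ℝ)

/-- `Δ = q₂³ − 27q₃²`. [folklore] -/
def discr (q₂ q₃ : ℚ) : ℝ := (q₂ : ℝ) ^ 3 - 27 * (q₃ : ℝ) ^ 2

/-- `σ = (e₃, e₂)`, written without roots exactly as in the crux. [folklore] -/
def σ₁ (q₂ q₃ : ℚ) : Set (Fin 1 → ℝ) :=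
  {p | 0 < cubic q₂ q₃ (p 0) ∧ ∃ t : ℝ, p 0 < t ∧ cubic q₂ q₃ t < 0}

/-- `σ' = (e₂, e₁)`. [folklore] -/
def σ₂ (q₂ q₃ : ℚ) : Set (Fin 1 → ℝ) :=
  {p | cubic q₂ q₃ (p 0) < 0 ∧ ∃ t : ℝ, t < p 0 ∧ 0 < cubic q₂ q₃ t}

/-- `σ'' = (e₁, ∞)`. [folklore] -/
def σ₃ (q₂ q₃ : ℚ) : Set (Fin 1 → ℝ) :=
  {p | 0 < cubic q₂ q₃ (p 0) ∧ ∀ t : ℝ, p 0 < t → 0 < cubic q₂ q₃ t}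

/-- `J₀ = ∫_σ dx/√f`. [folklore] -/
def J₀ (q₂ q₃ : ℚ) : ℝ := ∫ p in σ₁ q₂ q₃, 1 / Real.sqrt (cubic q₂ q₃ (p 0))
/-- `J₁ = ∫_σ x dx/√f`. [folklore] -/
def J₁ (q₂ q₃ : ℚ) : ℝ := ∫ p in σ₁ q₂ q₃, p 0 / Real.sqrt (cubic q₂ q₃ (p 0))
/-- `K₀ = ∫_{σ'} dx/√(−f)`. [folklore] -/
def K₀ (q₂ q₃ : ℚ) : ℝ := ∫ p in σ₂ q₂ q₃, 1 / Real.sqrt (- cubic q₂ q₃ (p 0))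
/-- `K₁ = ∫_{σ'} x dx/√(−f)`. [folklore] -/
def K₁ (q₂ q₃ : ℚ) : ℝ := ∫ p in σ₂ q₂ q₃, p 0 / Real.sqrt (- cubic q₂ q₃ (p 0))

/-- The inlined rigidity hypothesis of the crux (real-algebraic linear independence of
`1, J₀, J₁, K₀, K₁`). [folklore] -/
def Rigidity (q₂ q₃ : ℚ) : Prop :=
  ∀ a b c d e : ℝ, IsAlgebraic ℚ a → IsAlgebraic ℚ b → IsAlgebraic ℚ c → IsAlgebraic ℚ d →
    IsAlgebraic ℚ e →
    a + b * J₀ q₂ q₃ + c * J₁ q₂ q₃ + d * K₀ q₂ q₃ + e * K₁ q₂ q₃ = 0 →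
    a = 0 ∧ b = 0 ∧ c = 0 ∧ d = 0 ∧ e = 0

/-- The generating set `S` of the sector. [folklore] -/
def Gens (q₂ q₃ : ℚ) : Set KZ.FormalRep :=
  {c | ∃ (r : KZ.IntegralRep 1) (m : ℕ), r.domain = σ₁ q₂ q₃ ∧
      Set.EqOn r.integrand (fun p => p 0 ^ m / Real.sqrt (cubic q₂ q₃ (p 0))) (σ₁ q₂ q₃) ∧
      c = KZ.of r} ∪
  {c | ∃ (r : KZ.IntegralRep 1) (m : ℕ), r.domain = σ₂ q₂ q₃ ∧
      Set.EqOn r.integrand (fun p => p 0 ^ m / Real.sqrt (- cubic q₂ q₃ (p 0))) (σ₂ q₂ q₃) ∧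
      c = KZ.of r} ∪
  {c | ∃ (r : KZ.IntegralRep 1), r.domain = σ₃ q₂ q₃ ∧
      Set.EqOn r.integrand (fun p => 1 / Real.sqrt (cubic q₂ q₃ (p 0))) (σ₃ q₂ q₃) ∧
      c = KZ.of r}

/-- The kernel-form conclusion of the crux for one curve. [folklore] -/
def Kernel (q₂ q₃ : ℚ) : Prop :=
  ∀ c ∈ AddSubgroup.closure (Gens q₂ q₃), KZ.eval c = 0 → c ∈ KZ.relations

/-- The crux, unbundled: `∀ q₂ q₃, 0 < Δ → Rigidity → Kernel` (definitional). [folklore] -/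
theorem crux_iff :
    RealEllipticSectorKernel ↔ ∀ q₂ q₃ : ℚ, 0 < discr q₂ q₃ → Rigidity q₂ q₃ → Kernel q₂ q₃ :=
  Iff.rfl

/-! ### §1 Shape of any refutation: the crux follows from the kernel conjecture / the summit -/

/-- Any refutation of the crux refutes the kernel conjecture `ker eval = relations`
(`KZKernelConjecture`): the crux's conclusion is its restriction to the sector closure, and the
rigidity and discriminant hypotheses only weaken the crux further. [folklore] -/
theorem not_kzKernelConjecture_of_not (h : ¬ RealEllipticSectorKernel) : ¬ KZKernelConjecture :=
  fun hK => h (crux_iff.mpr fun _ _ _ _ c _ hc => hK c hc)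

/-- Any refutation of the crux refutes the summit (Conjecture 1 as formalised), via the proved
equivalence `kzKernelConjecture_iff_isRational`: there is no refutation of this crux cheaper than a
counterexample to Conjecture 1 on the real elliptic sector. [folklore] -/
theorem not_summit_of_not (h : ¬ RealEllipticSectorKernel) : ¬ _root_.KontsevichZagierPeriods :=
  fun hs => not_kzKernelConjecture_of_not h (kzKernelConjecture_iff_isRational.mpr hs)

/-- The shape every refutation must have: a concrete rational cubic with the inlined rigidity
PROVED (transcendence: Schneider/Masser, absent from the tree) and a kernel element outside
`relations` (which is `¬` summit on this sector, `not_summit_of_not`). [folklore] -/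
theorem not_iff :
    ¬ RealEllipticSectorKernel ↔
      ∃ q₂ q₃ : ℚ, 0 < discr q₂ q₃ ∧ Rigidity q₂ q₃ ∧
        ∃ c ∈ AddSubgroup.closure (Gens q₂ q₃), KZ.eval c = 0 ∧ c ∉ KZ.relations := by
  rw [crux_iff]
  simp only [Kernel, not_forall, exists_prop]

/-- TEMPLATE of a refutation: besides a curve with proved rigidity, an additive invariant `J`
vanishing on the four move sets and non-zero on some sector element of value `0` (soundness makes
`eval` such an invariant except for the last clause — `J` must see more than the value).
[folklore] -/
theorem not_of_separating_invariant {A : Type*} [AddCommGroup A] (J : KZ.FormalRep →+ A)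
    (hJ : ∀ x ∈ KZ.domainAddRel ∪ KZ.integrandAddRel ∪ KZ.changeOfVariablesRel ∪ KZ.newtonLeibnizRel,
      J x = 0)
    {q₂ q₃ : ℚ} (hΔ : 0 < discr q₂ q₃) (hrig : Rigidity q₂ q₃)
    (c : KZ.FormalRep) (hc : c ∈ AddSubgroup.closure (Gens q₂ q₃)) (hc0 : KZ.eval c = 0)
    (hJc : J c ≠ 0) : ¬ RealEllipticSectorKernel := by
  intro h
  have hker : KZ.relations ≤ J.ker := (AddSubgroup.closure_le _).mpr fun x hx => hJ x hx
  exact hJc (hker (crux_iff.mp h q₂ q₃ hΔ hrig c hc hc0))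

/-! ### §2 Load-bearing analysis: the discriminant hypothesis is redundant -/

/-- A `+ → −` sign change of `4x³ − Ax − B` along increasing `x` forces `A³ − 27B² > 0`:
through the intermediate root `e`, `A³ − 27B² = (A − 3e²)(12e² − A)²` with `A − 3e² > 0`
(the quadratic cofactor is negative at `x < e`) and `12e² ≠ A` (else `f = 4(y−e)²(y+2e)` has the
sign of `y + 2e`, incompatible with `x < t`). [folklore] -/
theorem discr_pos_of_sign_change {q₂ q₃ : ℚ} {x t : ℝ} (hxt : x < t) (hx : 0 < cubic q₂ q₃ x)
    (ht : cubic q₂ q₃ t < 0) : 0 < discr q₂ q₃ := by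
  set A : ℝ := (q₂ : ℝ) with hA
  set B : ℝ := (q₃ : ℝ) with hB
  have hf : ∀ y, cubic q₂ q₃ y = 4 * y ^ 3 - A * y - B := fun y => rfl
  have hcont : Continuous (cubic q₂ q₃) := by unfold cubic; fun_prop
  obtain ⟨e, he, he0⟩ : ∃ e ∈ Ioo x t, cubic q₂ q₃ e = 0 := by
    have := intermediate_value_Ioo' hxt.le hcont.continuousOn
    exact this ⟨ht, hx⟩
  rw [hf] at he0
  have hdisc := PeriodPair.cubic_discr_eq_of_root he0
  have hfac := PeriodPair.cubic_eq_mul_of_root he0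
  -- the quadratic cofactor is negative at `x < e`
  have hgx : 4 * x ^ 2 + 4 * e * x + (4 * e ^ 2 - A) < 0 := by
    have h1 : 0 < (x - e) * (4 * x ^ 2 + 4 * e * x + (4 * e ^ 2 - A)) := by
      rw [← hfac, ← hf]; exact hx
    have h2 : x - e < 0 := by linarith [he.1]
    by_contra hcon
    push Not at hcon
    have : (x - e) * (4 * x ^ 2 + 4 * e * x + (4 * e ^ 2 - A)) ≤ 0 :=
      mul_nonpos_of_nonpos_of_nonneg h2.le hcon
    linarith
  have hA3 : 0 < A - 3 * e ^ 2 := by nlinarith [sq_nonneg (2 * x + e)]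
  have h12 : 12 * e ^ 2 - A ≠ 0 := by
    intro h12
    have hft : cubic q₂ q₃ t = 4 * (t - e) ^ 2 * (t + 2 * e) := by
      rw [hf, hfac]; rw [show A = 12 * e ^ 2 by linarith]; ring
    have hfx : cubic q₂ q₃ x = 4 * (x - e) ^ 2 * (x + 2 * e) := by
      rw [hf, hfac]; rw [show A = 12 * e ^ 2 by linarith]; ring
    have h1 : 0 < x + 2 * e := by
      rw [hfx] at hx
      have hxe : x - e ≠ 0 := by linarith [he.1]
      have : 0 < 4 * (x - e) ^ 2 := by
        have := lt_of_le_of_ne (sq_nonneg (x - e)) (Ne.symm (pow_ne_zero 2 hxe)); linarith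
      by_contra hcon; push Not at hcon
      have : 4 * (x - e) ^ 2 * (x + 2 * e) ≤ 0 := mul_nonpos_of_nonneg_of_nonpos this.le hcon
      linarith
    have h2 : t + 2 * e < 0 := by
      rw [hft] at ht
      have h4 : 0 ≤ 4 * (t - e) ^ 2 := by positivity
      by_contra hcon; push Not at hcon
      have : 0 ≤ 4 * (t - e) ^ 2 * (t + 2 * e) := mul_nonneg h4 hcon
      linarith
    linarith
  show 0 < A ^ 3 - 27 * B ^ 2
  rw [hdisc]
  exact mul_pos hA3 (lt_of_le_of_ne (sq_nonneg _) (Ne.symm (pow_ne_zero 2 h12)))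

/-- The rigidity hypothesis forces `σ ≠ ∅` (else `J₀ = 0` and `b = 1` violates it). [folklore] -/
theorem sigma_nonempty_of_rigidity {q₂ q₃ : ℚ} (h : Rigidity q₂ q₃) : (σ₁ q₂ q₃).Nonempty := by
  by_contra hne
  rw [not_nonempty_iff_eq_empty] at hne
  have hJ : J₀ q₂ q₃ = 0 := by simp [J₀, hne]
  have := h 0 1 0 0 0 isAlgebraic_zero isAlgebraic_one isAlgebraic_zero isAlgebraic_zero
    isAlgebraic_zero (by simp [hJ])
  exact one_ne_zero this.2.1

/-- The inlined rigidity hypothesis already implies `0 < Δ`. [folklore] -/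
theorem discr_pos_of_rigidity {q₂ q₃ : ℚ} (h : Rigidity q₂ q₃) : 0 < discr q₂ q₃ := by
  obtain ⟨p, hp, t, hpt, ht⟩ := sigma_nonempty_of_rigidity h
  exact discr_pos_of_sign_change hpt hp ht

/-- The crux with the hypothesis `0 < Δ` deleted. [folklore] -/
def WithoutDiscr : Prop := ∀ q₂ q₃ : ℚ, Rigidity q₂ q₃ → Kernel q₂ q₃

/-- Deleting `0 < Δ` gives an equivalent statement: that hypothesis carries no weight
(information for the prover: it may be used freely, but nothing can hinge on it). [folklore] -/
theorem withoutDiscr_iff : WithoutDiscr ↔ RealEllipticSectorKernel := by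
  rw [crux_iff]
  exact ⟨fun h q₂ q₃ _ hr => h q₂ q₃ hr, fun h q₂ q₃ hr => h q₂ q₃ (discr_pos_of_rigidity hr) hr⟩

/-! ### §3 Load-bearing analysis: algebraicity of the coefficients keeps the hypothesis satisfiable -/

/-- With arbitrary REAL coefficients the independence hypothesis fails for every curve
(`a = −J₀`, `b = 1`); the restriction to real-algebraic coefficients is exactly what keeps the
crux from being vacuous. (The variant crux with this hypothesis is trivially TRUE.) [folklore] -/
theorem not_realCoeffRigidity (q₂ q₃ : ℚ) :
    ¬ ∀ a b c d e : ℝ,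
      a + b * J₀ q₂ q₃ + c * J₁ q₂ q₃ + d * K₀ q₂ q₃ + e * K₁ q₂ q₃ = 0 →
      a = 0 ∧ b = 0 ∧ c = 0 ∧ d = 0 ∧ e = 0 :=
  fun h => one_ne_zero (h (-J₀ q₂ q₃) 1 0 0 0 (by ring)).2.1

/-! ### §4 The hypothesis actually consumed: ℚ-linear independence of `(J₀, J₁, K₀, K₁)` -/

/-- ℚ-linear independence of `(J₀, J₁, K₀, K₁)` (no constant slot, rational coefficients):
what Hermite reduction + the two-torsion move actually need. [folklore] -/
def QRigidity (q₂ q₃ : ℚ) : Prop :=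
  ∀ b c d e : ℚ,
    (b : ℝ) * J₀ q₂ q₃ + (c : ℝ) * J₁ q₂ q₃ + (d : ℝ) * K₀ q₂ q₃ + (e : ℝ) * K₁ q₂ q₃ = 0 →
    b = 0 ∧ c = 0 ∧ d = 0 ∧ e = 0

/-- The inlined hypothesis implies the ℚ-version. [folklore] -/
theorem qRigidity_of_rigidity {q₂ q₃ : ℚ} (h : Rigidity q₂ q₃) : QRigidity q₂ q₃ := by
  intro b c d e hrel
  have hq : ∀ q : ℚ, IsAlgebraic ℚ (q : ℝ) := fun q => by
    simpa using isAlgebraic_algebraMap (R := ℚ) (A := ℝ) q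
  have := h 0 b c d e isAlgebraic_zero (hq b) (hq c) (hq d) (hq e) (by rw [zero_add]; exact hrel)
  exact ⟨by exact_mod_cast this.2.1, by exact_mod_cast this.2.2.1, by exact_mod_cast this.2.2.2.1,
    by exact_mod_cast this.2.2.2.2⟩

/-- The sharpened crux: same conclusion under ℚ-rigidity only (no `1`-slot, no `0 < Δ`). [folklore] -/
def Sharpened : Prop := ∀ q₂ q₃ : ℚ, QRigidity q₂ q₃ → Kernel q₂ q₃

/-- The sharpened statement implies the crux as filed; the intended proof (Hermite on
`σ`, `σ'` + two-torsion transfer + normal form) proves `Sharpened` verbatim, so the filed hypothesis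
is stronger than consumed (statement weaker than it could be — not a defect). [folklore] -/
theorem crux_of_sharpened (h : Sharpened) : RealEllipticSectorKernel :=
  crux_iff.mpr fun q₂ q₃ _ hr => h q₂ q₃ (qRigidity_of_rigidity hr)

/-! ### §5 Degenerate family `q₃ = 0` (CM by `i`): the hypothesis provably fails -/

/-- For `q₃ = 0` the cubic is odd. [folklore] -/
theorem cubic_neg_of_q₃_zero (q₂ : ℚ) (x : ℝ) : cubic q₂ 0 (-x) = - cubic q₂ 0 x := by
  simp only [cubic, Rat.cast_zero, sub_zero]; ring

/-- For `q₃ = 0`, `σ' = −σ`. [folklore] -/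
theorem σ₂_eq_preimage_neg (q₂ : ℚ) : σ₂ q₂ 0 = (fun p => -p) ⁻¹' σ₁ q₂ 0 := by
  ext p
  simp only [σ₁, σ₂, mem_preimage, mem_setOf_eq, Pi.neg_apply, cubic_neg_of_q₃_zero]
  constructor
  · rintro ⟨h1, t, ht, h2⟩
    refine ⟨by linarith, -t, by linarith, ?_⟩
    rw [cubic_neg_of_q₃_zero]; linarith
  · rintro ⟨h1, t, ht, h2⟩
    refine ⟨by linarith, -t, by linarith, ?_⟩
    have := cubic_neg_of_q₃_zero q₂ (-t)
    rw [neg_neg] at this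
    linarith

/-- `K₀ = J₀` on `y² = 4x³ − q₂x` (substitute `x ↦ −x`; in the calculus this is ONE
rule-2 move, so the resulting kernel element is derivable — no counterexample here). [folklore] -/
theorem K₀_eq_J₀_of_q₃_zero (q₂ : ℚ) : K₀ q₂ 0 = J₀ q₂ 0 := by
  haveI : (volume : Measure (Fin 1 → ℝ)).IsNegInvariant :=
    Measure.IsAddHaarMeasure.isNegInvariant_of_regular _
  have hN : MeasurePreserving (fun p : Fin 1 → ℝ => -p) volume volume :=
    Measure.measurePreserving_neg _
  have hemb : MeasurableEmbedding (fun p : Fin 1 → ℝ => -p) :=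
    (MeasurableEquiv.neg (Fin 1 → ℝ)).measurableEmbedding
  have key := hN.setIntegral_preimage_emb hemb
    (fun p => 1 / Real.sqrt (cubic q₂ 0 (p 0))) (σ₁ q₂ 0)
  simp only [Pi.neg_apply, cubic_neg_of_q₃_zero] at key
  unfold K₀ J₀
  rw [σ₂_eq_preimage_neg]
  exact key

/-- Hence the inlined hypothesis fails on the whole family `q₃ = 0` (`b = 1, d = −1`):
the crux is vacuous there by design (these are CM curves). [folklore] -/
theorem not_rigidity_q₃_zero (q₂ : ℚ) : ¬ Rigidity q₂ 0 := by
  intro h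
  have := h 0 1 0 (-1) 0 isAlgebraic_zero isAlgebraic_one isAlgebraic_zero isAlgebraic_one.neg
    isAlgebraic_zero (by rw [K₀_eq_J₀_of_q₃_zero]; ring)
  exact one_ne_zero this.2.1

/-! ### §6 The `EqOn`-presentation of the generators is harmless -/

/-- The empty representation (restriction of any `r` to `∅`) is a relation: `[e] − [e] − [e]` is a
domain-additivity move. [folklore] -/
theorem of_restrict_empty_mem {n : ℕ} (r : KZ.IntegralRep n) :
    KZ.of (r.restrict ∅ isSemialgebraic_empty (empty_subset _)) ∈ KZ.relations := by
  set e := r.restrict ∅ isSemialgebraic_empty (empty_subset _) with he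
  have h : KZ.of e - KZ.of e - KZ.of e ∈ KZ.domainAddRel :=
    ⟨n, e, e, e, by simp [e], by simp [e], fun _ _ => rfl, fun _ _ => rfl, rfl⟩
  have h1 := KZ.domainAddRel_subset_relations h
  rw [sub_self, zero_sub] at h1
  exact neg_mem_iff.mp h1

/-- Two representations with the same domain whose integrands agree ON the domain are
equivalent (one rule-1a move splitting off the empty representation). So the many generators of
`S` presenting the same integral differ by relations, as the kernel conclusion demands. [folklore] -/
theorem equivalent_of_eqOn {n : ℕ} {r r' : KZ.IntegralRep n} (hd : r'.domain = r.domain)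
    (hi : EqOn r.integrand r'.integrand r.domain) : KZ.Equivalent r r' := by
  set e := r.restrict ∅ isSemialgebraic_empty (empty_subset _) with he
  have h : KZ.of r - KZ.of r' - KZ.of e ∈ KZ.domainAddRel :=
    ⟨n, r, r', e, by simp [e, hd], by simp [e], by rw [hd]; exact hi, by simp [e], rfl⟩
  have h1 := KZ.domainAddRel_subset_relations h
  have h2 := of_restrict_empty_mem r
  have h3 := KZ.relations.add_mem h1 h2
  simpa [KZ.Equivalent, e] using h3

end Summit.KontsevichZagierPeriods.RealEllipticSectorKernel.Negative

end
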